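import Mathlib
import Summits.Parity.GeneralizedHardyLittlewood.Theorems.FordMaynardSieveConst01651SieveConst01651MainCaseKernel

/-!
# Route `FordMaynardSieveConst01651`, target `SieveConst01651` (stmt-Parity-19185), line `sieve_decomposition`:
# Ford–Maynard Proposition 7.19 at `P = (1/2, 0, ν)` WITHOUT the growth / lower-bound hypotheses on `w`

Ford–Maynard, arXiv:2407.14368v1, Proposition 7.19 / proof of Proposition 7.22, at `(γ, θ, ν) = (1/2, 0, ν)`:
`|∑_{n ∈ ℛ} w(n) H(n)| ≤ K x/(log x)^A` for every `w` with (I) at level `x^{1/2}` and (II) on `(1, x^ν]` (exponent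
`B ≥ B₀(A, g, ν)`).  PROOF ROUTE (integer thresholds, no Perron shells): the boundary part of `ℛ` is `≪ x/(log x)^B` by
(I) (`…RsetSplit.Rset_edge_abs_sum_le`); the main part `n₁ > 1` is the bilinear form of
`…MainCaseReindex.sum_main_eq_sum_bilinear` in (prime `d = P⁺(u)`) × (`z = (e, m, u')`); `g(𝐯(m; de))` is expanded
over the polytope pieces of `g` (`IsPiecewiseConstOnCone`), each face being a condition `∑ aᵢ log pᵢ < b log(de)`;
every entangling condition is monotone in `d` (`…MainCaseMonotone`), hence an integer threshold separable at cost
`3(1 + log(2N+4))` (`…MonotoneThresholds`), and (II) in `BilinBoundedBy` form (`…TypeIIBilin`) with the long-side fibre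
lift finishes (`…MainCaseKernel.bilin_main_kernel`, `main_kernel_eq`).  No lower bound on `w` and no use of the growth
condition (w) are needed at `θ = 0`.

* `typeIIRegion_of_typeI_typeII` — the same conclusion as the landed stub `…TypeIIRegion.stub_typeIIRegion`, from
  (I) and (II) ALONE (no `GrowthBound`, no `w n ≥ -x^{ν/10}`, no `ϖ`): the statement of the v20 skeleton's stub,
  strengthened; it shows that the v21 re-typing of the stub was not needed at `θ = 0`.  (Same proof, fewer binders.)

Def-free. Nothing here proves anything about the Parity summit; a strengthening of one landed stub of one leaf.
-/

open Finset Literature.NumberTheory.Sieve Literature.NumberTheory.Sieve.FordMaynard Literature.Barriers.Parity.FordMaynard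
open Literature.NumberTheory.Sieve.FriedlanderIwaniecPrimes

namespace Summit.Parity.GeneralizedHardyLittlewood.FordMaynardSieveConst01651SieveConst01651

open scoped Classical

/-- **Ford–Maynard Proposition 7.19 at `P = (1/2, 0, ν)` from (I) and (II) alone.** For `0 < ν < 1/4`,
admissible `g` and `A ≥ 1` there is `B₀` (`= A + R + 4`, `R` the total face count of the pieces of `g` in dimensions
`≤ 1/ν`) such that for `B ≥ B₀` there are `K, x₀` with `|∑_{n ∈ ℛ} w(n) H(n)| ≤ K x/(log x)^A` for all `x ≥ x₀` and
ALL real sequences `w` satisfying (I) at level `x^{1/2}` and (II) on `(1, x^ν]` with exponent `B` — no growth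
condition (w), no lower bound on `w`.  (At `θ = 0` every entangling condition is an integer threshold in the Type-II
prime `d = P⁺(u)`, so Lemma 7.10's shells — the only place where `w_n ≥ -x^{ν/10}` enters the printed proof — do not
occur.) [cite: FordMaynard2024PrimeSieves, Proposition 7.19 (via the proof of Proposition 7.22) at (γ, θ, ν) = (1/2, 0, ν)] -/
theorem typeIIRegion_of_typeI_typeII :
    ∀ ν : ℝ, 0 < ν → ν < 1 / 4 → ∀ g : VecFn, Admissible ν g →
      ∀ A : ℝ, 1 ≤ A → ∃ B₀ : ℝ, ∀ B : ℝ, B₀ ≤ B → ∃ K x₀ : ℝ, ∀ x : ℝ, x₀ ≤ x →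
        ∀ w : ℕ → ℝ, TypeI w x (1 / 2) B → TypeII w x 0 ν B →
          |∑ n ∈ Rset ν x, w n * Hwt g ν n| ≤ K * x / Real.log x ^ A := by
  intro ν hν0 hν4 g hadm A hA
  have hpc : IsPiecewiseConstOnCone g := hadm.2.1
  have hsupp := hadm.2.2.2.1
  have hν1 : ν < 1 := by linarith
  -- the pieces of `g` and their faces
  have hpc' : ∀ k : ℕ, ∃ (mP : ℕ) (Pc : Fin mP → Set (Fin k → ℝ)) (cc : Fin mP → ℝ),
      (∀ j, IsConvexPolytope (Pc j) ∧ Pc j ⊆ {x | Monotone x}) ∧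
        ∀ x : Fin k → ℝ, Monotone x → g k x = ∑ j, if x ∈ Pc j then cc j else 0 := hpc
  choose nP P c hPc hgP using hpc'
  have hfaces : ∀ (k : ℕ) (j : Fin (nP k)), ∃ S T : Finset ((Fin k → ℝ) × ℝ),
      P k j = {v | (∀ cf ∈ S, ∑ i, cf.1 i * v i < cf.2) ∧ ∀ cf ∈ T, ∑ i, cf.1 i * v i ≤ cf.2} :=
    fun k j => (hPc k j).1.2
  choose S T hST using hfaces
  set K₀ : ℕ := ⌊1 / ν⌋₊ with hK₀
  set R : ℕ := ∑ k ∈ Finset.range (K₀ + 1), ∑ j : Fin (nP k), ((S k j).card + (T k j).card) with hR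
  set Cg : ℝ := ∑ k ∈ Finset.range (K₀ + 1), ∑ j : Fin (nP k), |c k j| with hCg
  have hCg0 : 0 ≤ Cg := Finset.sum_nonneg fun k _ => Finset.sum_nonneg fun j _ => abs_nonneg _
  obtain ⟨Ce, hCe0, hCe⟩ := Rset_edge_abs_sum_le hν0 (by linarith) hpc
  refine ⟨A + R + 4, fun B hB => ⟨Ce + Cg * 12 ^ (R + 4), 3, fun x hx w hI hII => ?_⟩⟩
  have hx2 : 2 ≤ x := by linarith
  have hx1 : 1 ≤ x := by linarith
  have hx0 : 0 < x := by linarith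
  have hRnn : (0 : ℝ) ≤ R := Nat.cast_nonneg _
  have hB2 : 2 ≤ B := by linarith
  have hBA : A ≤ B := by linarith
  have hB0 : 0 ≤ B := by linarith
  -- `log x ≥ 1`
  have hlog : 1 ≤ Real.log x := by
    rw [Real.le_log_iff_exp_le hx0]
    have := Real.exp_one_lt_d9
    linarith
  have hlog0 : 0 < Real.log x := by linarith
  -- split `ℛ` into the main part and the boundary part
  rw [sum_Rset_eq_main_add_edge hx2]
  -- the boundary part, by (I)
  have hedge : |∑ n ∈ (Rset ν x).filter
        (fun n : ℕ => smoothPart ((n : ℝ) ^ ν) n = 1 ∧ (n.minFac : ℝ) ≤ (n : ℝ) ^ ν), w n * Hwt g ν n|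
      ≤ Ce * x / Real.log x ^ A := by
    refine (Finset.abs_sum_le_sum_abs _ _).trans ((hCe x hx2 B hB0 w hI).trans ?_)
    rw [mul_div_assoc, mul_div_assoc]
    refine mul_le_mul_of_nonneg_left ?_ hCe0
    exact div_le_div_of_nonneg_left hx0.le (Real.rpow_pos_of_pos hlog0 _)
      (Real.rpow_le_rpow_of_exponent_le hlog hBA)
  -- the main part, by (II)
  have hmain : |∑ n ∈ (Rset ν x).filter (fun n : ℕ => 1 < smoothPart ((n : ℝ) ^ ν) n), w n * Hwt g ν n|
      ≤ Cg * 12 ^ (R + 4) * x / Real.log x ^ A := by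
    rw [sum_main_eq_sum_bilinear hν0 hν1 hsupp hx2 w]
    set W₀ := (Icc 1 ⌊x ^ ((0 : ℝ) + ν)⌋₊).filter (fun m : ℕ => (x / 2) ^ (0 : ℝ) < (m : ℝ)) with hW₀
    set Z := (Icc 1 ⌊x⌋₊).biUnion
      (fun e : ℕ => (e.divisors ×ˢ e.divisors).image (fun s : ℕ × ℕ => (e, s))) with hZ
    have hW₀2 : ∀ d ∈ W₀, 2 ≤ d := by
      intro d hd
      rw [hW₀, Finset.mem_filter, Real.rpow_zero] at hd
      exact_mod_cast hd.2
    have hZfacts : ∀ z ∈ Z, 1 ≤ z.1 ∧ z.2.1 ∣ z.1 := by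
      intro z hz
      rw [hZ, Finset.mem_biUnion] at hz
      obtain ⟨e, he, hz⟩ := hz
      rw [Finset.mem_image] at hz
      obtain ⟨s, hs, rfl⟩ := hz
      rw [Finset.mem_product] at hs
      exact ⟨(Finset.mem_Icc.mp he).1, Nat.dvd_of_mem_divisors hs.1⟩
    -- constants
    set N := ⌊x⌋₊ with hN
    set cN : ℝ := 3 * (1 + Real.log (2 * (N + 1 : ℕ) + 2)) with hcN
    set X : ℝ := x / Real.log x ^ B with hX
    have hX0 : 0 ≤ X := div_nonneg hx0.le (Real.rpow_nonneg hlog0.le _)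
    have hlogN : 0 ≤ Real.log (2 * (N + 1 : ℕ) + 2) := by
      apply Real.log_nonneg
      have : (0 : ℝ) ≤ ((N + 1 : ℕ) : ℝ) := Nat.cast_nonneg _
      linarith
    have hcN1 : 1 ≤ cN := by rw [hcN]; linarith
    have hcNle : cN ≤ 12 * Real.log x := by
      have hNx : (N : ℝ) ≤ x := Nat.floor_le hx0.le
      have h4 : Real.log (2 * (N + 1 : ℕ) + 2) ≤ Real.log 4 + Real.log x := by
        rw [← Real.log_mul (by norm_num) hx0.ne']
        apply Real.log_le_log
        · have : (0 : ℝ) ≤ ((N + 1 : ℕ) : ℝ) := Nat.cast_nonneg _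
          linarith
        · push_cast; linarith
      have hlog4 : Real.log 4 ≤ 2 := by
        rw [Real.log_le_iff_le_exp (by norm_num)]
        have h1 := Real.add_one_le_exp (1 : ℝ)
        have : Real.exp 2 = Real.exp 1 * Real.exp 1 := by rw [← Real.exp_add]; norm_num
        nlinarith [Real.exp_pos (1 : ℝ)]
      rw [hcN]; linarith
    -- the per-piece summand
    set T₁ : (k : ℕ) → Fin (nP k) → ℕ × (ℕ × (ℕ × ℕ)) → ℝ := fun k j b =>
      if (b.1.Prime ∧ (b.1 : ℝ) < ((b.1 * b.2.1 : ℕ) : ℝ) ^ ν ∧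
          (∀ p ∈ b.2.2.1.primeFactors, ((b.1 * b.2.1 : ℕ) : ℝ) ^ ν ≤ (p : ℝ)) ∧
          (∀ p ∈ b.2.2.2.primeFactors, p < b.1) ∧ Squarefree b.2.2.2 ∧
          (x / 2 < (b.1 * b.2.1 : ℝ) ∧ (b.1 * b.2.1 : ℝ) ≤ x)) then
        w (b.1 * b.2.1) *
          (if ((b.1 * b.2.2.2 * b.2.2.1 : ℕ) : ℝ) ≤ ((b.1 * b.2.1 : ℕ) : ℝ) ^ (1 / 2 : ℝ) then 0
            else ((ArithmeticFunction.moebius b.2.2.2 : ℤ) : ℝ) *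
              (if b.2.2.1.primeFactorsList.length = k then
                (if (fun i : Fin k => Real.log (b.2.2.1.primeFactorsList.getD i 0) /
                    Real.log ((b.1 * b.2.1 : ℕ) : ℝ)) ∈ P k j then (1 : ℝ) else 0)
              else 0))
      else 0 with hT₁
    -- step 1: expand `g(𝐯(m; de))` over the pieces
    have hexp : ∀ b ∈ W₀ ×ˢ Z,
        (if (b.1.Prime ∧ (b.1 : ℝ) < ((b.1 * b.2.1 : ℕ) : ℝ) ^ ν ∧
              (∀ p ∈ b.2.2.1.primeFactors, ((b.1 * b.2.1 : ℕ) : ℝ) ^ ν ≤ (p : ℝ)) ∧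
              (∀ p ∈ b.2.2.2.primeFactors, p < b.1) ∧ Squarefree b.2.2.2 ∧
              (x / 2 < (b.1 * b.2.1 : ℝ) ∧ (b.1 * b.2.1 : ℝ) ≤ x)) then
            w (b.1 * b.2.1) *
              (if ((b.1 * b.2.2.2 * b.2.2.1 : ℕ) : ℝ) ≤ ((b.1 * b.2.1 : ℕ) : ℝ) ^ (1 / 2 : ℝ) then 0
                else ((ArithmeticFunction.moebius b.2.2.2 : ℤ) : ℝ) *
                  g _ (pvec (b.1 * b.2.1) b.2.2.1))
          else 0) = ∑ k ∈ Finset.range (K₀ + 1), ∑ j : Fin (nP k), c k j * T₁ k j b := by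
      intro b hb
      rw [Finset.mem_product] at hb
      obtain ⟨hdW, hzZ⟩ := hb
      have hd2 := hW₀2 _ hdW
      obtain ⟨he1, hme⟩ := hZfacts _ hzZ
      simp only [hT₁]
      by_cases hcond : (b.1.Prime ∧ (b.1 : ℝ) < ((b.1 * b.2.1 : ℕ) : ℝ) ^ ν ∧
          (∀ p ∈ b.2.2.1.primeFactors, ((b.1 * b.2.1 : ℕ) : ℝ) ^ ν ≤ (p : ℝ)) ∧
          (∀ p ∈ b.2.2.2.primeFactors, p < b.1) ∧ Squarefree b.2.2.2 ∧
          (x / 2 < (b.1 * b.2.1 : ℝ) ∧ (b.1 * b.2.1 : ℝ) ≤ x))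
      · simp only [if_pos hcond]
        by_cases hcut : ((b.1 * b.2.2.2 * b.2.2.1 : ℕ) : ℝ) ≤ ((b.1 * b.2.1 : ℕ) : ℝ) ^ (1 / 2 : ℝ)
        · simp only [if_pos hcut, mul_zero, Finset.sum_const_zero]
        · simp only [if_neg hcut]
          have hK : b.2.2.1.primeFactorsList.length ≤ K₀ :=
            length_primeFactorsList_le_floor hν0 hd2 (by omega) hme hcond.2.2.1
          rw [apply_pvec_expand g nP P c hgP hK, Finset.mul_sum, Finset.mul_sum]
          refine Finset.sum_congr rfl fun k _ => ?_
          rw [Finset.mul_sum, Finset.mul_sum]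
          refine Finset.sum_congr rfl fun j _ => ?_
          split_ifs <;> ring
      · simp only [if_neg hcond, mul_zero, Finset.sum_const_zero]
    rw [Finset.sum_congr rfl hexp, Finset.sum_comm]
    -- step 2: per piece, the separated bilinear bound
    have hpiece : ∀ k ∈ Finset.range (K₀ + 1), ∀ j : Fin (nP k),
        |∑ b ∈ W₀ ×ˢ Z, T₁ k j b| ≤ cN ^ (R + 4) * X := by
      intro k hk j
      have hker := (bilin_main_kernel hν0 hν1 hx1 hB2 hII k (S k j) (T k j)).congr
        (fun d hd z hz => main_kernel_eq (ν := ν) (x := x) (w := w) (hST k j) (hW₀2 d hd) (hZfacts z hz).1)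
      have hval : ‖∑ d ∈ W₀, ∑ z ∈ Z, (1 : ℂ) * 1 * ((T₁ k j (d, z) : ℝ) : ℂ)‖ ≤
          cN ^ ((S k j).card + (T k j).card + 4) * X :=
        hker (fun _ => 1) (fun _ => 1) (fun _ => by simp) (fun _ => by simp)
      have hcast : (∑ d ∈ W₀, ∑ z ∈ Z, (1 : ℂ) * 1 * ((T₁ k j (d, z) : ℝ) : ℂ)) =
          ((∑ d ∈ W₀, ∑ z ∈ Z, T₁ k j (d, z) : ℝ) : ℂ) := by
        push_cast
        simp only [one_mul]
      rw [hcast, Complex.norm_real, Real.norm_eq_abs, ← Finset.sum_product (W₀) (Z) (T₁ k j)] at hval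
      refine hval.trans (mul_le_mul_of_nonneg_right (pow_le_pow_right₀ hcN1 ?_) hX0)
      have h1 : (S k j).card + (T k j).card ≤ ∑ j' : Fin (nP k), ((S k j').card + (T k j').card) :=
        Finset.single_le_sum (f := fun j' => (S k j').card + (T k j').card) (fun _ _ => Nat.zero_le _)
          (Finset.mem_univ j)
      have h2 : ∑ j' : Fin (nP k), ((S k j').card + (T k j').card) ≤ R :=
        Finset.single_le_sum (f := fun k' => ∑ j' : Fin (nP k'), ((S k' j').card + (T k' j').card))
          (fun _ _ => Nat.zero_le _) hk
      omega
    -- step 3: add up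
    have htotal : |∑ k ∈ Finset.range (K₀ + 1), ∑ b ∈ W₀ ×ˢ Z, ∑ j : Fin (nP k), c k j * T₁ k j b|
        ≤ Cg * (cN ^ (R + 4) * X) := by
      refine (Finset.abs_sum_le_sum_abs _ _).trans ?_
      rw [hCg, Finset.sum_mul]
      refine Finset.sum_le_sum fun k hk => ?_
      rw [Finset.sum_comm]
      refine (Finset.abs_sum_le_sum_abs _ _).trans ?_
      rw [Finset.sum_mul]
      refine Finset.sum_le_sum fun j _ => ?_
      rw [← Finset.mul_sum, abs_mul]
      exact mul_le_mul_of_nonneg_left (hpiece k hk j) (abs_nonneg _)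
    refine htotal.trans ?_
    have hkey : Real.log x ^ (R + 4) * x / Real.log x ^ B ≤ x / Real.log x ^ A := by
      have h1 : Real.log x ^ (R + 4) * x / Real.log x ^ B = x / Real.log x ^ (B - ((R + 4 : ℕ) : ℝ)) := by
        rw [Real.rpow_sub hlog0, Real.rpow_natCast, div_div_eq_mul_div]
        ring
      rw [h1]
      refine div_le_div_of_nonneg_left hx0.le (Real.rpow_pos_of_pos hlog0 _)
        (Real.rpow_le_rpow_of_exponent_le hlog ?_)
      push_cast
      linarith
    calc Cg * (cN ^ (R + 4) * X) ≤ Cg * ((12 * Real.log x) ^ (R + 4) * X) :=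
          mul_le_mul_of_nonneg_left (mul_le_mul_of_nonneg_right
            (pow_le_pow_left₀ (by linarith) hcNle _) hX0) hCg0
      _ = Cg * 12 ^ (R + 4) * (Real.log x ^ (R + 4) * x / Real.log x ^ B) := by
          rw [mul_pow, hX]; ring
      _ ≤ Cg * 12 ^ (R + 4) * (x / Real.log x ^ A) :=
          mul_le_mul_of_nonneg_left hkey (by positivity)
      _ = Cg * 12 ^ (R + 4) * x / Real.log x ^ A := by ring
  -- conclusion
  calc |∑ n ∈ (Rset ν x).filter (fun n : ℕ => 1 < smoothPart ((n : ℝ) ^ ν) n), w n * Hwt g ν n +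
          ∑ n ∈ (Rset ν x).filter
            (fun n : ℕ => smoothPart ((n : ℝ) ^ ν) n = 1 ∧ (n.minFac : ℝ) ≤ (n : ℝ) ^ ν), w n * Hwt g ν n|
        ≤ |∑ n ∈ (Rset ν x).filter (fun n : ℕ => 1 < smoothPart ((n : ℝ) ^ ν) n), w n * Hwt g ν n| +
          |∑ n ∈ (Rset ν x).filter
            (fun n : ℕ => smoothPart ((n : ℝ) ^ ν) n = 1 ∧ (n.minFac : ℝ) ≤ (n : ℝ) ^ ν), w n * Hwt g ν n| :=
        abs_add_le _ _
    _ ≤ Cg * 12 ^ (R + 4) * x / Real.log x ^ A + Ce * x / Real.log x ^ A := add_le_add hmain hedge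
    _ = (Ce + Cg * 12 ^ (R + 4)) * x / Real.log x ^ A := by ring

end Summit.Parity.GeneralizedHardyLittlewood.FordMaynardSieveConst01651SieveConst01651
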